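import Summits.CriticalPhenomena.PercolationContinuityZ3.Theorems.Transplant.SkelPhiFaceKitsG
import Summits.CriticalPhenomena.PercolationContinuityZ3.Theorems.Transplant.SkelPhiForcedFaceKitClauseC
import Summits.CriticalPhenomena.PercolationContinuityZ3.Theorems.Transplant.SkelPhiFaceKitsGFC
import Literature.Probability.Percolation.OrientedHistorySiteRenormalizationRun
import Summits.CriticalPhenomena.PercolationContinuityZ3.Theorems.Transplant.SkelPhiFaceDataNS
import Summits.CriticalPhenomena.PercolationContinuityZ3.Theorems.Transplant.SkelPhiFaceDataNbS
import Summits.CriticalPhenomena.PercolationContinuityZ3.Theorems.Transplant.SkelPhiFaceKitsRunNbS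
import Summits.CriticalPhenomena.PercolationContinuityZ3.Theorems.Transplant.PlanarCells2SDefs
import HarnessLib
/-!
(R-35)/J12 successor `…C` of `SkelPhiFaceKitsGFS` (hp-8 g40, 2026-08-23): the forced kit is RE-CENTRED AT THE COLUMN END (p1-g17's `kitClauseFC` /
`kitClause_runXFC/YFC` / `kitClause_frameFC` / `kitClause_rootFrameFC`, binder list lane 03:18:28Z): the fat-prism rows `hkz / hRk· / hΛcyl` (and `hfr / hκ`,
which only fed them) and the column row `hcol` are GONE (`ctCtr ↦ ctColEnd`, `ψ_ctColEnd_mem_Icc` / `ctColEnd_reach`, SkelPhiForcedColumnPlace); every other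
binder and the proof body are verbatim — mentions of those rows below describe the superseded `SkelPhiFaceKitsGFS`.

# N2 (frames-only node `SamePDropOfSkeletonFrm₁`, OPEN) — WAVE 1, (F) face-data column over STAGGERED cells ((R-22) `PCells2S`, (R-28)(β) one landing per file): the twin of N1's `SkelPhiFaceKitsGF`

NON-VACUITY (lead g11 STANDING ORDER 2026-08-23T03:52:56Z (2)(b)): this file only THREADS its window / region / zone rows to p1-g17's re-centred
kit clause (`kitClauseFC` family, whose kept rows `hRg/hΛRg/hzconn/hcz/hDρ/hKCmax` have the witness `Λc := cylBallFin c kz R`, `Rg := Λc`,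
`Rs :=` its graph extent — p1-g17 03:09:30Z / (R-35) (3)); the FULL binder set of the theorems below is instantiated JOINTLY, at the closed terms of
record, by the (F) wrapper `faceHoldsRNQFnLT_frmChoiceAllQ3` (stmt-g20's Face params/glue twins over `KS0.kit0_ok` SkelFrmBChoiceNums p347587,
`hlong_of_atQ3/hlongY_of_atQ3` SkelFrmBChoiceLinks p351172, hp-8's SkelPhiCellsRoomsS/RootRoomsS) — non-vacuity: discharged jointly by that wrapper.
builds on p205010 (kernel theorem, internal audit signed; external expert review pending) — nothing in this file uses p205010; NOTHING is claimed about the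
open node `SamePDropOfSkeletonFrm₁` (`SamePDropOfSkeletonNeg₁` is CLOSED in the tree and untouched by this file).
Status sentence (coordinator 2026-08-20T04:30Z): "θ(p_c) = 0 on ℤ^d, all d ≥ 2 — kernel-verified (Lean 4/Mathlib, standard axioms); internal adversarial
audit SIGNED 2026-08-20 04:29Z; external expert review pending."
Lane `prim-bschramm`, seat `prim-hp-8` (gen 40); helper file (`--supports stmt-CriticalPhenomena-4575 --as helper`); design owner p3-g15 ((R-22) staggered
cells `PCells2S`, (R-27)/(R-29) far regions of record `FarNS/FarNS₂`, (R-28)(β), naming 2026-08-22T23:00:04Z: suffix `S`).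
PORT RULES (HOME/prim-hp-8/code/gen40/orient/bin/port_s.py = stmt-g19's port_orient.py + the G token table): the cells are `P : PCells2S`, every box is
read about the STAGGERED centre `cenS` (`PlanarCells2SDefs/SFar/ContainS/SArm/SepS/SepInfS/LevelsS/EfarN2S`), the scheme record is `cellGeomSG₂S`/`cellGeomSG₂bS`
(`SkelPhiCellsWeakGS/…SmallMS`: narrow arm `BtwNS`, two-block far region `FarNS₂`), the history-site API is the ORIENTED one at `qNE` where it occurs
(`ochoice qNE`, `onwardO`, `Valid₂O`, `IsRun₂O`, …, (R-18)); EVERY declaration is re-declared with the suffix `S` (same namespace). Docstrings/citations are N1's.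
N1 HEADER (kept for the reader):
* **`FinePrm.hkits_face_of_routeFC`**, **`hkits_faceStepWNbFC`**.
[cite: KozmaNitzan2024, §4 Lemma 10 (pp. 17–21), Lemma 12 (pp. 23–25), p. 30 (Step III)] [cite: MartineauTassion2017, §4.3 Lemma 4.2]
-/
noncomputable section

open scoped Classical

namespace Summit.CriticalPhenomena.PercolationContinuityZ3.Theorems.Transplant

namespace Skelφ

open MeasureTheory
open Literature.Probability.Percolation Literature.Probability.LatticeModels SimpleGraph KNLevels GadgetSystem Contour
open Literature.Barriers.CriticalPhenomena (graphBall graphBall_finite mem_graphBall_self graphBall_mono)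
open Skel (winGraph winGraph_adj winGraph_le KitGeom WinStepData)
open SkelI (tanOff tanTgt tanTgt_mem)
open Literature.Probability.Percolation.KozmaNitzan.Cells (oth oth_ne eq_oth_of_ne oth_oth)
open BoxProdZ2 (ConcRadiiG)

variable {V : Type} [DecidableEq V] {G : SimpleGraph V} [G.LocallyFinite] {φ : V → Site 2}

namespace FinePrm

end FinePrm

/-- **THE FORCED KIT CLAUSE OF LEVEL `j′ ∈ [M+1, Rlev]` OF THE FACE STEP `faceStepWNbS`** (the `hkits` hypothesis of `faceOblRM_fineNbS`'s
F-twin at one level; the (S0) twin of `hkits_faceStepWNbG`), from the zone datum rows and a route at accuracy `δ³` at every centre of the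
`E`-enlarged level box inside `B(w₀, rE − r)`. [cite: KozmaNitzan2024, §4 Lemma 10 (pp. 17–21), p. 30 (Step III)] [cite: MartineauTassion2017, §4.3 Lemma 4.2] -/
theorem hkits_faceStepWNbFSC [Countable V] (hlipφ : Lip G φ) (hstep : Steps G φ)
 {Δ : ℕ} (hΔ : ∀ v, G.degree v ≤ Δ) {q : unitInterval} {δ : ℝ} (hδ : 0 < δ)
    -- the face frame at the window centre
    (pr : FinePrm) (w₀ : V) (du : MDir) (b : Fin 2) (hc₀ : 0 < pr.c₀) (hc₁ : 0 < pr.c₁) (hD : 0 < pr.D) (hL0 : pr.c₀ * pr.L 0 ≤ pr.D)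
    (hL1 : pr.c₁ * pr.L 1 ≤ pr.D) (hA0 : 0 < pr.A) (hb : |pr.lvGen du.1 (oth b)| ≤ |pr.lvGen du.1 b|)
    (hnz : pr.lvGen du.1 b ≠ 0) {nF : ℕ} (hnC : (nF : ℤ) ≤ pr.cOf du.1 * |pr.A| * |pr.lvGen du.1 b|) (hU3 : pr.D ≤ 3 * (nF : ℤ))
    -- the face step
    (P : PCells2S) (Λ : ConcRadiiG) (b₀ : Fin 2 → ℕ) (a' : ℕ) (x : Site 2) (j : ℕ) (pc : ℤ) (aw Rlev N M L' : ℕ) (Sfin : Finset V)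
    {yF : V} (hyF : pr.ψ φ w₀ yF = P.faceCen x du j) (hpc : pc = relφ φ w₀ yF b) (hjK : j + 1 ≤ P.K) (hRlev : Rlev + 4 ≤ 10 * P.s du.1)
    (hRlev' : (Rlev : ℤ) + 5 + P.c du.1 ≤ 3 * P.r (oth du.1)) {kF : ℤ}
    (hroomF : pr.Mabs * (aw + Rlev + 1) + pr.rdN du.1 b * (Rlev + 2) * pr.D ≤ pr.rdK du.1 b * kF * pr.D) (hkF : kF + 3 + P.c du.1 ≤ 5 * P.r (oth du.1))
    {j' : ℕ} (hj'M : M + 1 ≤ j') (hj'R : j' ≤ Rlev)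
    -- kit constants
    (PA : ApronPrm) {nz Rs KCmax rs cS cU E r : ℕ} (hPN : 3 ≤ PA.N) (hA : PA.A = (nz + 1 : ℕ) * pr.D + 1)
    (hdD : PA.d + 2 ≤ shellD PA) (hDρ : Rs + 1 ≤ shellD PA) (hKCmax : (shellD PA + nz + 1) * 3 ≤ KCmax)
    (hMtan : tanOff PA.ℓs PA.M ≤ (M : ℤ) + 1) (hMd : PA.d + 2 ≤ 2 * M + 2) (hMD : shellD PA + 1 + PA.d + KCmax + Rs ≤ 2 * M + 2)
    (hT' : (shellD PA : ℤ) + KCmax + Rs ≤ tanOff PA.ℓs PA.M)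
    (hr₀ : PA.N * (tanOff PA.ℓs PA.M + 2) + PA.N * PA.d + (KCmax + Rs) ≤ PA.r₀) (hR : PA.r₀ ≤ Λ.rE a' x du)
    (hrs : 1 + (PA.N * (tanOff PA.ℓs PA.M + 2) + PA.N * PA.d + (KCmax + Rs)) ≤ rs)
    (hcS : (PA.N + 1) * (tanOff PA.ℓs PA.M + 1) + (PA.N + 1) * PA.d + (KCmax + 1) + cU ≤ cS)
    (hE : Rlev + (PA.N * (tanOff PA.ℓs PA.M + 1) + PA.N * PA.d + KCmax) ≤ E)
    (hreach : r + (PA.N * (tanOff PA.ℓs PA.M + 1) + PA.N * PA.d + KCmax) ≤ PA.r₀)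
    (hrim : Λ.rM a' (x + stepVec du) - L' + PA.r₀ ≤ Λ.rE a' x du)
    -- the short region and the zone datum at the kit centres (inside `Rg`, connected, containing the centre and the fat-prism box `cylBallFin c kz Rk`)
    (Rg : V → Finset V) (hRg : ∀ c, ∀ u ∈ Rg c, u ∈ graphBall G c Rs) (hRgcard : ∀ c, (Rg c).card ≤ cU) (hcU1 : 1 ≤ cU)
    (Λc : V → ℕ → Finset V) (kz : ℕ) (hΛRg : ∀ c, Λc c kz ⊆ Rg c) (hzconn : ∀ c, ∀ s ∈ Λc c kz, PathIn G (↑(Λc c kz) : Set V) c s)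
    (hcz : ∀ c, c ∈ Λc c kz)

    (kk : ℕ) {Wt : Sym2 V → unitInterval}
    (hN : kk * (Δ + 1) ^ (2 * rs) ≤ N) (hk : (1 - (q : ℝ) ^ (1 + Δ * cS + cS * cU)) ^ kk ≤ δ)
    -- THE ROUTE at every centre of the enlarged box near the window centre, at accuracy `δ³`
    (hroute : ∀ c, pr.frame φ w₀ du.1 b c ∈ Finset.Icc (loNS P x du j pc aw - ((E : ℕ) : Site 2)) (hiNS P x du j pc aw + ((E : ℕ) : Site 2)) →
      c ∈ graphBall G w₀ (Λ.rE a' x du - r) →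
      ∃ Qt Ft : Finset V, Ft ⊆ (faceStepWNbS G pr φ P w₀ Λ b₀ b a' x du j pc aw Rlev N M L' Sfin).T ∧
        Qt ⊆ stepRg G (pr.frame φ w₀ du.1 b) (faceStepWNbS G pr φ P w₀ Λ b₀ b a' x du j pc aw Rlev N M L' Sfin) ∧
        1 - δ ^ 3 ≤ (prodBernoulli Wt).real (linkIn (↑Qt : Set V) (Λc c kz) Ft)) :
    let Q := faceStepWNbS G pr φ P w₀ Λ b₀ b a' x du j pc aw Rlev N M L' Sfin
    ∃ (σ : KNLevels.SData V) (Sz : Finset V),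
      KNLevels.SHyp (winLData G (pr.frame φ w₀ du.1 b) Q.root Q.Rπ Q.lo Q.hi Q.root Q.Sfin) j' σ ∧ σ.N ≤ Q.N ∧
      (1 - (q : ℝ) ^ σ.sB) ^ σ.k ≤ δ ∧ Sz ⊆ stepRg G (pr.frame φ w₀ du.1 b) Q ∧ (∀ x' ∈ σ.K, σ.face x' ⊆ Sz) ∧
      KNLevels.RelayClause (winLData G (pr.frame φ w₀ du.1 b) Q.root Q.Rπ Q.lo Q.hi Q.root Q.Sfin) Wt j' σ Sz Q.T
        (stepRg G (pr.frame φ w₀ du.1 b) Q) δ := by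
  intro Q
  -- the wide level box
  have hw := loN_hiN_hwideS P x du j pc aw hj'M
  have hwide : ∀ i, (loNS P x du j pc aw - (j' : Site 2)) i + 2 * tanOff PA.ℓs PA.M ≤ (hiNS P x du j pc aw + (j' : Site 2)) i := fun i => by
    have := hw i; linarith
  have hMd' : ((PA.d + 2 : ℕ) : ℤ) ≤ 2 * M + 2 := by exact_mod_cast hMd
  have hMD' : ((shellD PA + 1 + PA.d + KCmax + Rs : ℕ) : ℤ) ≤ 2 * M + 2 := by exact_mod_cast hMD
  have hdw : ∀ i, (loNS P x du j pc aw - (j' : Site 2)) i + (PA.d + 2 : ℕ) ≤ (hiNS P x du j pc aw + (j' : Site 2)) i := fun i => by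
    have := hw i; linarith
  have hDw : ∀ i, (loNS P x du j pc aw - (j' : Site 2)) i + ((shellD PA + 1 + PA.d + KCmax + Rs : ℕ) : ℤ) ≤ (hiNS P x du j pc aw + (j' : Site 2)) i :=
    fun i => by have := hw i; linarith
  -- the level inside the region; the far part inside the rim
  have hXD : winLevel G (pr.frame φ w₀ du.1 b) w₀ (Λ.rE a' x du) (loNS P x du j pc aw) (hiNS P x du j pc aw) j' ⊆
      stepRg G (pr.frame φ w₀ du.1 b) Q :=
    winLevel_subset_stepRg_faceStepWNbS G φ P w₀ Λ b₀ a' N M L' Sfin hyF hpc hjK hRlev hRlev' hc₀ hc₁ hD hnz hroomF hkF (by omega)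
  have hfarT : ∀ v ∈ winLevel G (pr.frame φ w₀ du.1 b) w₀ (Λ.rE a' x du) (loNS P x du j pc aw) (hiNS P x du j pc aw) j',
      v ∉ graphBall G w₀ (Λ.rE a' x du - PA.r₀) → v ∈ Q.T := fun v hv hfar =>
    far_mem_faceStepWNb_TS G φ pr P w₀ Λ b₀ b a' x du j pc aw Rlev N M L' Sfin hrim (hXD hv) hfar
  have hE' : j' + (PA.N * (tanOff PA.ℓs PA.M + 1) + PA.N * PA.d + KCmax) ≤ E := le_trans (by omega) hE
  exact FinePrm.hkits_face_of_routeFC hlipφ hstep hΔ hδ pr w₀ du.1 b hD hL0 hL1 (pr.cOf_pos hc₀ hc₁ du.1) hA0 hb hnz hnC hU3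
    PA hPN hA hdD hDρ hKCmax hwide hdw hDw hT' hr₀ hR hrs hcS hE' hreach Rg hRg hRgcard hcU1 Λc kz hΛRg hzconn hcz
    kk w₀ Sfin hXD hfarT hN hk hroute

end Skelφ

end Summit.CriticalPhenomena.PercolationContinuityZ3.Theorems.Transplant

end
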